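import Summits.QuantumFields.YangMills.Theorems.BalabanUVNodesN15KingModelAnalyticDeterminantBlockTermLipschitz
import Summits.QuantumFields.YangMills.Theorems.BalabanUVNodesN15KingModelAnalyticDeterminantVolumeLawEtaUniform
import HarnessLib

/-!
# BalabanUVNodes ∕ N15 — THE KING-MODEL RUNG (PART Ϯ-p): THE ℓ¹-LIPSCHITZ LOCAL LAW — LOCALITY AND LIPSCHITZ AT ONCE for NE2's unit-layer normalisation:
# `|ln det Δ_eff(U) − ln det Δ_eff(V)| ≤ 4c·G(0,0)·Σ_bΣ_{ij}|U(b)_{ij} − V(b)_{ij}| + (2a|n|∕m²)·Σ_b‖U(b) − V(b)‖` at EVERY pair of unitary backgrounds (no support hypothesis: the right-hand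
# side only sees the bonds where `U ≠ V`, each weighted by the SIZE of the change), and in `d+1 = 4` at King's scaling `c = L²` the constant `4c·G(0,0) ≤ 5 + 4∕m²` is η-UNIFORM —
# PART Ϭ-d (Lipschitz, global) and PART Ϯ-d (local, crude) in one statement
# (Track A, DAG node N15 = NE2; FAN-OUT v1.1 §N15 s3 «KING-MODEL RUNG … + what the curved case adds»; count-neutral)

HONEST FRAMING.  Count-neutral (cell `pub-ymgap`, seat `pub-ymgap-dag-n15-e` g54; `--supports stmt-QuantumFields-27247 --as helper` = K3ᴬ, KEY MAP v3).  King's one-level comparison model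
(Bałaban's covariant block mean on a tree contour system), unitary `U, V`, `a > 0` (`≥ 0` for `A₀`), `c ≥ 0`, `m² > 0`, any fibre; `d+1 = 4` and equal periods where «η-uniform» is said.  NOT King's
multi-step `Z_k`; NOT Bałaban's (3.42); NOT a node discharge (N15 of record untouched); nothing continuum ∕ ℝ⁴ ∕ OS ∕ Clay.

CONTENT.  §1 ★ `abs_re_trace_fullOpU_inv_mul_sub_le_l1` (response at either endpoint: fine part Ϯ-b∕Ϯ-c `2cG(0,0)‖U−V‖_{ℓ¹}`, block part Ϯ-o `a(2|n|∕m²)Σ‖U(b)−V(b)‖`), ★★★ `abs_log_re_det_fullOpU_sub_le_l1`,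
★★★★ **`abs_log_re_det_effLapU_sub_le_l1`** (`|Δ ln det Δ_eff| ≤ 4cG(0,0)‖U−V‖_{ℓ¹} + (2a|n|∕m²)Σ_b‖U(b)−V(b)‖`); §2 (`d+1 = 4`, `c = L²`) ★★★★ **`abs_log_re_det_effLapU_sub_le_l1_eta_uniform`**
(`≤ (5 + 4∕m²)‖U−V‖_{ℓ¹} + (2a|n|∕m²)Σ_b‖U(b)−V(b)‖`, every `L`, every volume, every tree contour system).

PRIOR TREE ART (by name, not restated): Ϯ-b `abs_log_re_det_sub_le_of_re_trace_le`∕`abs_re_trace_mul_covLapF_sub_le`∕`abs_log_re_det_covLapF_sub_le_l1`, Ϯ-c `norm_fullOpU_inv_entry_le_diag_zero`, Ϯ-o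
`abs_re_trace_mul_blockProjU_sub_le_l1`, Ϭ-a `log_re_det_effLapU_eq`, Ϯ-e `king_green_diag_eta_uniform'`, Ϥ-d `fullOpU_eq`, Ϥ-k `posDef_fullOpU_massive`.
Dedup (rg at filing): basename 0 files; `abs_re_trace_fullOpU_inv_mul_sub_le_l1|abs_log_re_det_fullOpU_sub_le_l1|abs_log_re_det_effLapU_sub_le_l1|abs_log_re_det_effLapU_sub_le_l1_eta_uniform` 0 tree files.
Locators: [King1986] (2.13)–(2.14) p.653, (3.89)–(3.90) pp.668–669, (3.94)–(3.96) p.669, (4.4)–(4.5) p.670, (4.35) p.674; [Balaban1985BackgroundPropagators] (3.19) p.393, (3.23)–(3.25) p.394, (3.42) p.397.  0 `sorry`, 0 `def`.  v1.1 (g55, DOC-ONLY, ERRATUM-Ϯ2 = ref-I READ-1104 N1∕N2): l.74 wording on the `(L, M)`-dependence of `4c·G(0,0)`; this Locators line += (3.94)–(3.96) p.669 (cited at §1); declarations byte-identical.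
-/

noncomputable section

open scoped BigOperators ComplexConjugate ComplexOrder Matrix.Norms.L2Operator
open Finset Matrix WithLp

namespace Summit.QuantumFields.YangMills.BalabanUVNodes.N15KingModelRung.Analytic

open Literature.MathematicalPhysics.QuantumFieldTheory.Balaban1983to89.B5Prop11Plancherel (Tor fine)
open Literature.MathematicalPhysics.QuantumFieldTheory.King1986.Torus (lapF)
open Literature.MathematicalPhysics.QuantumFieldTheory.Balaban1983to89.Beta.WoodburyFibre (cM)
open Summit.QuantumFields.YangMills.BalabanUVNodes.N15KingModelRung.Covariant (covLapF lapF_inv_entry_nonneg)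
open Summit.QuantumFields.YangMills.BalabanUVNodes.N15KingModelRung.CovariantBlock

/-! ## §1 The ℓ¹-Lipschitz local law on every torus -/

section General

variable {d : ℕ} {L : ℕ} [NeZero L] (T : BlockTree d L) (M : Fin (d + 1) → ℕ) [hM : ∀ μ, NeZero (M μ)]
variable {𝕜 : Type*} [RCLike 𝕜] {n : Type*} [Fintype n] [DecidableEq n]
variable {a c m2 : ℝ} (hc : 0 ≤ c) (hm : 0 < m2)
variable {U V : Tor (fine L M) × Fin (d + 1) → Matrix n n 𝕜} (hU : ∀ bd, U bd ∈ Matrix.unitaryGroup n 𝕜) (hV : ∀ bd, V bd ∈ Matrix.unitaryGroup n 𝕜)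
include hc hm hU hV

/-- ★ THE RESPONSE OF `ln det A₀` AT EITHER ENDPOINT, ℓ¹ FORM: for unitary `W`,
`|Re tr(A₀(W)⁻¹(A₀(U) − A₀(V)))| ≤ 2c·G(0,0)·Σ_bΣ_{ij}|U(b)_{ij}−V(b)_{ij}| + a·(2|n|∕m²)·Σ_b‖U(b)−V(b)‖` (fine part: Kato + Loewner, Ϯ-b∕Ϯ-c; block part: Ϯ-o).
[cite: King1986, (2.13) p.653, (3.94)–(3.96) p.669; Balaban1985BackgroundPropagators, (3.19) p.393, (3.23)–(3.25) p.394, (3.42) p.397] -/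
theorem abs_re_trace_fullOpU_inv_mul_sub_le_l1 (ha : 0 ≤ a) {W : Tor (fine L M) × Fin (d + 1) → Matrix n n 𝕜} (hW : ∀ bd, W bd ∈ Matrix.unitaryGroup n 𝕜) :
    |RCLike.re ((fullOpU T M a c m2 W)⁻¹ * (fullOpU T M a c m2 U - fullOpU T M a c m2 V)).trace|
      ≤ 2 * c * (lapF (fine L M) c m2)⁻¹ 0 0 * (∑ b, ∑ i, ∑ j, ‖U b i j - V b i j‖) + a * (2 * (Fintype.card n : ℝ) * m2⁻¹ * ∑ bd, ‖U bd - V bd‖) := by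
  have hsplit : fullOpU T M a c m2 U - fullOpU T M a c m2 V
      = (covLapF (fine L M) c m2 U - covLapF (fine L M) c m2 V) + (a : 𝕜) • (blockProjU T M U - blockProjU T M V) := by
    rw [fullOpU_eq, fullOpU_eq, smul_sub]; abel
  rw [hsplit, Matrix.mul_add, Matrix.trace_add, map_add, Matrix.mul_smul, Matrix.trace_smul, smul_eq_mul, RCLike.re_ofReal_mul]
  refine (abs_add_le _ _).trans (add_le_add ?_ ?_)
  · exact abs_re_trace_mul_covLapF_sub_le (fine L M) (norm_fullOpU_inv_entry_le_diag_zero T M ha hc hm hW) hc m2 U V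
  · rw [abs_mul, abs_of_nonneg ha]
    exact mul_le_mul_of_nonneg_left (abs_re_trace_mul_blockProjU_sub_le_l1 T M ha hc hm hU hV hW) ha

/-- ★★★ **THE ℓ¹-LIPSCHITZ LOCAL LAW FOR `ln det A₀`**: `|ln det A₀(U) − ln det A₀(V)| ≤ 2c·G(0,0)·‖U−V‖_{ℓ¹} + (2a|n|∕m²)·Σ_b‖U(b)−V(b)‖` at every pair of unitary backgrounds.
[cite: King1986, (2.13)–(2.14) p.653, (3.89)–(3.90) pp.668–669; Balaban1985BackgroundPropagators, (3.23)–(3.25) p.394, (3.42) p.397] -/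
theorem abs_log_re_det_fullOpU_sub_le_l1 (ha : 0 ≤ a) :
    |Real.log (RCLike.re (fullOpU T M a c m2 U).det) - Real.log (RCLike.re (fullOpU T M a c m2 V).det)|
      ≤ 2 * c * (lapF (fine L M) c m2)⁻¹ 0 0 * (∑ b, ∑ i, ∑ j, ‖U b i j - V b i j‖) + a * (2 * (Fintype.card n : ℝ) * m2⁻¹ * ∑ bd, ‖U bd - V bd‖) :=
  abs_log_re_det_sub_le_of_re_trace_le (posDef_fullOpU_massive T M ha hc hm hV) (posDef_fullOpU_massive T M ha hc hm hU)
    (abs_re_trace_fullOpU_inv_mul_sub_le_l1 T M hc hm hU hV ha hV) (abs_re_trace_fullOpU_inv_mul_sub_le_l1 T M hc hm hU hV ha hU)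

/-- ★★★★ **THE ℓ¹-LIPSCHITZ LOCAL LAW FOR NE2's UNIT-LAYER NORMALISATION**: at every pair of unitary backgrounds (no support hypothesis),
`|ln det Δ_eff(U) − ln det Δ_eff(V)| ≤ 4c·G(0,0)·Σ_bΣ_{ij}|U(b)_{ij} − V(b)_{ij}| + (2a|n|∕m²)·Σ_b‖U(b) − V(b)‖` — the right-hand side sees only the bonds where the background changed, each weighted by
the size of its change; the explicit constant `4c·G(0,0) = 4c·(lapF (fine L M) c m²)⁻¹(0,0)` has no contour-depth dependence but DOES depend on the torus `(L, M)` through King's diagonal `G(0,0)` (always `≤ 1∕m²`, so `O(c∕m²)`; η-UNIFORM only in `d+1 = 4` at `c = L²` by Ϯ-e, see §2 below), while the block-term constant `2a|n|∕m²` has no `L`, no volume and no contour-depth dependence (Ϭ-a split + Ϯ-b fine law + the full law above). [v1.1 ERRATUM-Ϯ2, ref-I READ-1104 N1: v1.0 said «no `L`, no volume … dependence» of the whole constant.]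
[cite: King1986, (2.13)–(2.14) p.653, (3.89)–(3.90) pp.668–669, (4.4)–(4.5) p.670; Balaban1985BackgroundPropagators, (3.19) p.393, (3.23)–(3.25) p.394, (3.42) p.397] -/
theorem abs_log_re_det_effLapU_sub_le_l1 (ha : 0 < a) :
    |Real.log (RCLike.re (effLapU T M a c m2 U).det) - Real.log (RCLike.re (effLapU T M a c m2 V).det)|
      ≤ 4 * c * (lapF (fine L M) c m2)⁻¹ 0 0 * (∑ b, ∑ i, ∑ j, ‖U b i j - V b i j‖) + a * (2 * (Fintype.card n : ℝ) * m2⁻¹ * ∑ bd, ‖U bd - V bd‖) := by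
  have hU' := log_re_det_effLapU_eq T M ha hc hm hU
  have hV' := log_re_det_effLapU_eq T M ha hc hm hV
  have h1 := abs_log_re_det_covLapF_sub_le_l1 (fine L M) hc hm hU hV
  have h2 := abs_log_re_det_fullOpU_sub_le_l1 T M hc hm hU hV ha.le
  have e : Real.log (RCLike.re (effLapU T M a c m2 U).det) - Real.log (RCLike.re (effLapU T M a c m2 V).det)
      = (Real.log (RCLike.re (covLapF (fine L M) c m2 U).det) - Real.log (RCLike.re (covLapF (fine L M) c m2 V).det))
        - (Real.log (RCLike.re (fullOpU T M a c m2 U).det) - Real.log (RCLike.re (fullOpU T M a c m2 V).det)) := by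
    rw [hU', hV']; ring
  rw [e]
  refine (abs_sub _ _).trans ?_
  linarith

end General

/-! ## §2 `d+1 = 4`, King's scaling: the η-uniform ℓ¹-Lipschitz local law -/

section Four

variable {L : ℕ} [NeZero L] (T : BlockTree 3 L) (M₀ : ℕ) [NeZero M₀]
variable {𝕜 : Type*} [RCLike 𝕜] {n : Type*} [Fintype n] [DecidableEq n]
variable {a m2 : ℝ} (ha : 0 < a) (hm : 0 < m2)
variable {U V : Tor (fine L (cM M₀)) × Fin (3 + 1) → Matrix n n 𝕜} (hU : ∀ bd, U bd ∈ Matrix.unitaryGroup n 𝕜) (hV : ∀ bd, V bd ∈ Matrix.unitaryGroup n 𝕜)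
include ha hm hU hV

/-- ★★★★ **THE η-UNIFORM ℓ¹-LIPSCHITZ LOCAL LAW** (`d+1 = 4`, King's scaling `c = L²`, fine torus `(ℤ∕LM₀)⁴`, every `L, M₀ ≥ 1`, every tree contour system, any `RCLike` fibre): at every pair of
unitary backgrounds, `|ln det Δ_eff(U) − ln det Δ_eff(V)| ≤ (5 + 4∕m²)·Σ_bΣ_{ij}|U(b)_{ij} − V(b)_{ij}| + (2a|n|∕m²)·Σ_b‖U(b) − V(b)‖` — local (only changed bonds), Lipschitz (size of the change),
and uniform in the spacing `η = L⁻¹` (Ϯ-e: `4L²G(0,0) ≤ 5 + 4∕m²`). [cite: King1986, (2.13)–(2.14) p.653, (3.89)–(3.90) pp.668–669, (4.4)–(4.5) p.670, (4.35) p.674;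
Balaban1985BackgroundPropagators, (3.19) p.393, (3.23)–(3.25) p.394, (3.42) p.397] -/
theorem abs_log_re_det_effLapU_sub_le_l1_eta_uniform :
    |Real.log (RCLike.re (effLapU T (cM M₀) a ((L : ℝ) ^ 2) m2 U).det) - Real.log (RCLike.re (effLapU T (cM M₀) a ((L : ℝ) ^ 2) m2 V).det)|
      ≤ (5 + 4 * m2⁻¹) * (∑ b, ∑ i, ∑ j, ‖U b i j - V b i j‖) + a * (2 * (Fintype.card n : ℝ) * m2⁻¹ * ∑ bd, ‖U bd - V bd‖) := by
  have h := abs_log_re_det_effLapU_sub_le_l1 T (cM M₀) (c := (L : ℝ) ^ 2) (by positivity) hm hU hV ha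
  have hg := king_green_diag_eta_uniform' L M₀ hm (0 : Tor (fine L (cM M₀)))
  have hS : (0 : ℝ) ≤ ∑ b, ∑ i, ∑ j, ‖U b i j - V b i j‖ :=
    Finset.sum_nonneg fun _ _ => Finset.sum_nonneg fun _ _ => Finset.sum_nonneg fun _ _ => norm_nonneg _
  refine h.trans (add_le_add ?_ le_rfl)
  have e : 4 * (L : ℝ) ^ 2 * (lapF (fine L (cM M₀)) ((L : ℝ) ^ 2) m2)⁻¹ 0 0 = 4 * ((L : ℝ) ^ 2 * (lapF (fine L (cM M₀)) ((L : ℝ) ^ 2) m2)⁻¹ 0 0) := by ring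
  rw [e]
  exact mul_le_mul_of_nonneg_right (by linarith) hS

end Four

end Summit.QuantumFields.YangMills.BalabanUVNodes.N15KingModelRung.Analytic

end
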